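import Literature.NumberTheory.LFunctions.SubnormalZetaGapsOffLine
import Literature.NumberTheory.LFunctions.LOneLowerBoundParityHalves
import Literature.NumberTheory.LFunctions.DedekindCloseZeroHypothesis
import Literature.NumberTheory.LFunctions.DirichletZeroDetector
import Literature.NumberTheory.QuadraticFields.QuadraticDedekindZetaZeros
import Literature.NumberTheory.QuadraticFields.QuadraticDedekindZetaOddPrimitive
import HarnessLib

/-!
# Route `PrimeLevelFamEdge` — TYPED IDEA DELTAS, deck 19a: the weakest unknown consequences of the Conrey–Iwaniec
# door hypothesis `X := ∃ c > 0, SubnormalGapsHypothesis c` — the DISTINCT-CRITICAL FLOOR and the (κ,σ)-EDGE (§0–§2)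

LANDING NOTE (typer ls-idea-typ-1 gen 2, cell ls-idea): the seat's `Sketch_Wuc24.lean` v1.1 sha16 195cf539609374a8
(seat ls-idea-lens-24, `wuc` × CI-GAPS; cards K-L24-1 «THE DOOR HAS AN EDGE» / K-L24-2; critic F b5/b8 PASS as PROVED
COMPOSITIONS modulo the NAMED FACT `conreyIwaniec2002_theorem11`; T-L24-1 discharged in sketch form) VERBATIM up to the
namespace (`Literature.NumberTheory.LFunctions.Wuc24` → the deck namespace `.WucSigma`), the split 19a (§0–§2) / 19b
(§3–§5) for the 400-line rule, four added docstrings, the seat's `closeCriticalZeros_finite'` dropped (tree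
`BGMM2023.closeCriticalZeros_finite`) and `one_le_log_of_exp_one_le` private (tree duplicate).  Landed Summits-side (uncited compositions over tree objects;
the q-odd fidelity of the FACT is kept in the docstrings, F P-F6-1); the CI-GAPS door of record reads «X ⇒ odd 75 via
Thm 1.1 (ψ = 1, A = 57/4) mod FACT `conreyIwaniec2002_theorem11` │ odd 90 via Thm 1.2 mod FACT `…theorem12`» — never
«75 proved» (F P-F6-2).


Typed ≠ proved: this file DEFINES two families of consequences of `X` and PROVES only the easy
implications FROM `X` (and monotonicity).  Nothing here proves `X`, any rung below, the odd leaf, or any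
exceptional-zero statement.  No Riemann hypothesis anywhere.

* §1 `CritCloseOrMultiple Λ` (K-L24-2, the DISTINCT-CRITICAL FLOOR): beyond every height there is a
  critical zero `½+iγ` of `ζ` that is multiple or has ANOTHER critical zero within `Λ` mean spacings
  `2π/log γ`.  `X ⇒ CritCloseOrMultiple Λ` for every `Λ ≥ ½` (`critCloseOrMultiple_of_subnormalGaps`).
  Unconditionally KNOWN in print only for `Λ > 1/0.4075 ≈ 2.454` (pigeonhole on the ≥ 40.75 % simple
  critical zeros of Pratt–Robles–Zaharescu–Zeindler, arXiv:1802.10521, as quoted in arXiv:2010.10675 p. 4);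
  open for `½ ≤ Λ ≤ 2.454` — the first rung any producer of `X` must clear.
* §2 `SubnormalGapsHypothesisSigma κ σ` (K-L24-1, the (κ,σ)-EDGE): `≫ T (log T)^{1−κ}` ordinates
  `2 ≤ γ ≤ T` with a close critical neighbour at Conrey–Iwaniec radius `π(1−α_T)/log γ`,
  `α_T = (log T)^{−σ}`.  `X ⇒ SubnormalGapsHypothesisSigma (1/5) σ` for `σ ≥ ½`
  (`sigma_of_subnormalGaps`), monotone (weaker) in `κ ↑`, `σ ↑` (`SubnormalGapsHypothesisSigma.mono`).
  With `conreyIwaniec2002_theorem11` at `ψ = 1`, `α = (log T)^{−σ}`, `log T = (log q)^{A+6}` the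
  pair `(κ,σ)` still opens the odd-leaf door iff `κ + σ < 1` (budget lemma `sigma_budget_pos`); the
  composition itself is NOT proved here (it needs the factorisation `ζ_K = ζ·L(χ)` on the critical line,
  absent from the tree — cf. `AmplifiedMixedMomentPurity` hypotheses `hζ`).
-/

noncomputable section

namespace Summit.Parity.GeneralizedHardyLittlewood.Theorems.PrimeLevelFamEdgeIdeaDeltas.WucSigma

open _root_.Complex NumberField Literature.NumberTheory.LFunctions.NumberField
open Literature.NumberTheory.LFunctions Literature.NumberTheory.LFunctions.ConreyIwaniec2002

/-! ### §0 Helpers -/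

/-- Ordinates `0 < γ ≤ T` of critical zeros of `ζ` form a finite set (zero box). -/
theorem critOrdinates_finite (T : ℝ) :
    {γ : ℝ | 0 < γ ∧ γ ≤ T ∧ riemannZeta (1 / 2 + γ * I) = 0}.Finite := by
  refine ((zetaZeroBox_finite 0 T).image Complex.im).subset ?_
  rintro γ ⟨h0, hT, hz⟩
  refine ⟨1 / 2 + γ * I, ⟨hz, ?_, ?_, ?_, ?_⟩, ?_⟩ <;> simp <;> linarith

/-- `closeZeroOrdinates ζ α T` is finite. -/
theorem closeZeroOrdinates_riemannZeta_finite (α T : ℝ) :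
    (closeZeroOrdinates riemannZeta α T).Finite :=
  (closeZeroOrdinatesC_riemannZeta_finite α T).subset
    (closeZeroOrdinates_subset_closeZeroOrdinatesC riemannZeta α T)

/-- `1 ≤ log T` for `T ≥ e` (private copy; the tree has `one_le_log_of_exp_le` in `PretentiousZeta`). [folklore] -/
private theorem one_le_log_of_exp_one_le {T : ℝ} (hT : Real.exp 1 ≤ T) : 1 ≤ Real.log T := by
  have := Real.log_le_log (Real.exp_pos 1) hT
  rwa [Real.log_exp] at this

/-- `e ≤ 2001`. [folklore] -/
theorem exp_one_le_2001 : Real.exp 1 ≤ (2001 : ℝ) := by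
  have := Real.exp_one_lt_d9
  linarith

/-- From `X`: beyond every height `T₁` there is an element of `closeCriticalZeros T` for a suitable `T`. -/
theorem exists_large_mem_closeCriticalZeros {c : ℝ} (hc : 0 < c) (hX : SubnormalGapsHypothesis c)
    (T₁ : ℝ) : ∃ T γ : ℝ, γ ∈ closeCriticalZeros T ∧ T₁ < γ := by
  classical
  set S : Set ℝ := {γ : ℝ | 0 < γ ∧ γ ≤ T₁ ∧ riemannZeta (1 / 2 + γ * I) = 0} with hS
  have hSfin : S.Finite := critOrdinates_finite T₁
  set M : ℕ := S.ncard with hM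
  set T : ℝ := max 2001 ((M + 1) / c) with hTdef
  have hT2001 : (2001 : ℝ) ≤ T := le_max_left _ _
  have hTpos : 0 < T := by linarith
  have hcount := hX T hT2001
  by_contra hcon
  push Not at hcon
  have hsub : closeCriticalZeros T ⊆ S := by
    intro γ hγ
    have hle : γ ≤ T₁ := by
      by_contra h
      exact absurd (hcon T γ hγ) (by push Not; linarith)
    exact ⟨hγ.1, hle, hγ.2.2.1⟩
  have hcard : ((closeCriticalZeros T).ncard : ℝ) ≤ M := by
    exact_mod_cast Set.ncard_le_ncard hsub hSfin
  have hlog : 1 ≤ Real.log T := one_le_log_of_exp_one_le (exp_one_le_2001.trans hT2001)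
  have hpow : 1 ≤ Real.log T ^ ((4 : ℝ) / 5) := Real.one_le_rpow hlog (by norm_num)
  have hcT : (M : ℝ) + 1 ≤ c * T := by
    have : ((M : ℝ) + 1) / c ≤ T := le_max_right _ _
    rwa [div_le_iff₀ hc, mul_comm] at this
  have : c * T * 1 ≤ c * T * Real.log T ^ ((4 : ℝ) / 5) :=
    mul_le_mul_of_nonneg_left hpow (by positivity)
  linarith

/-! ### §1 K-L24-2 — the distinct-critical floor -/

/-- **`CritCloseOrMultiple Λ`**: beyond every height there is an ordinate `γ ≥ 2` with `ζ(½+iγ) = 0`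
and (`ζ′(½+iγ) = 0` or another critical zero `½+iγ′`, `γ′ ≠ γ`, `|γ−γ′| ≤ Λ·2π/log γ`).
KNOWN unconditionally only for `Λ > 2.454` (pigeonhole, arXiv:1802.10521 via arXiv:2010.10675 p. 4);
OPEN for `½ ≤ Λ ≤ 2.454`; implied by the door hypothesis for every `Λ ≥ ½`. -/
def CritCloseOrMultiple (Λ : ℝ) : Prop :=
  ∀ T₀ : ℝ, ∃ γ : ℝ, T₀ ≤ γ ∧ 2 ≤ γ ∧ HasCloseZero riemannZeta (Λ * (2 * Real.pi / Real.log γ)) γ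

/-- The distinct-critical floor is monotone (weaker) in the radius `Λ`. -/
theorem CritCloseOrMultiple.mono {Λ Λ' : ℝ} (hΛ : Λ ≤ Λ') (h : CritCloseOrMultiple Λ) :
    CritCloseOrMultiple Λ' := by
  intro T₀
  obtain ⟨γ, hT₀, h2, hγ⟩ := h T₀
  have hlog : 0 < Real.log γ := Real.log_pos (by linarith)
  refine ⟨γ, hT₀, h2, hγ.mono ?_⟩
  exact mul_le_mul_of_nonneg_right hΛ (by positivity)

/-- `ciRadius γ ≤ ½ · (2π / log γ)` for `γ > 1`. -/
theorem ciRadius_le_half_spacing {γ : ℝ} (hγ : 1 < γ) :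
    ciRadius γ ≤ 1 / 2 * (2 * Real.pi / Real.log γ) := by
  unfold ciRadius
  have hlog : 0 < Real.log γ := Real.log_pos hγ
  have hs : 0 ≤ 1 / Real.sqrt (Real.log γ) := by positivity
  have h1 : Real.pi / Real.log γ * (1 - 1 / Real.sqrt (Real.log γ)) ≤ Real.pi / Real.log γ * 1 :=
    mul_le_mul_of_nonneg_left (by linarith) (by positivity)
  calc Real.pi / Real.log γ * (1 - 1 / Real.sqrt (Real.log γ))
      ≤ Real.pi / Real.log γ * 1 := h1
    _ = 1 / 2 * (2 * Real.pi / Real.log γ) := by ring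

/-- **X ⇒ the floor at every `Λ ≥ ½`.** -/
theorem critCloseOrMultiple_of_subnormalGaps {c : ℝ} (hc : 0 < c) (hX : SubnormalGapsHypothesis c)
    {Λ : ℝ} (hΛ : 1 / 2 ≤ Λ) : CritCloseOrMultiple Λ := by
  intro T₀
  obtain ⟨T, γ, hγ, hlt⟩ := exists_large_mem_closeCriticalZeros hc hX (max T₀ 2)
  have hT₀ : T₀ ≤ γ := le_trans (le_max_left _ _) hlt.le
  have h2 : 2 ≤ γ := le_trans (le_max_right _ _) hlt.le
  have hclose : HasCloseZero riemannZeta (ciRadius γ) γ :=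
    (hasCloseZero_riemannZeta_ciRadius_iff γ).2 hγ.2.2
  have hlog : 0 < Real.log γ := Real.log_pos (by linarith)
  refine ⟨γ, hT₀, h2, hclose.mono ?_⟩
  calc ciRadius γ ≤ 1 / 2 * (2 * Real.pi / Real.log γ) := ciRadius_le_half_spacing (by linarith)
    _ ≤ Λ * (2 * Real.pi / Real.log γ) := mul_le_mul_of_nonneg_right hΛ (by positivity)

/-- The DISTINCT-PAIR sibling (what sign-change certificates for Hardy's `Z` deliver; NOT implied by
`X` as typed, since (1.22) counts a multiple zero as its own neighbour): two distinct critical zeros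
within `Λ` mean spacings beyond every height. Known unconditionally only for `Λ > 2.454` (pigeonhole). -/
def CritClosePair (Λ : ℝ) : Prop :=
  ∀ T₀ : ℝ, ∃ γ γ' : ℝ, T₀ ≤ γ ∧ 2 ≤ γ ∧ γ' ≠ γ ∧ riemannZeta (1 / 2 + γ * I) = 0 ∧
    riemannZeta (1 / 2 + γ' * I) = 0 ∧ |γ - γ'| ≤ Λ * (2 * Real.pi / Real.log γ)

/-- A close critical PAIR gives the close-or-multiple floor at the same radius. -/
theorem CritClosePair.toCloseOrMultiple {Λ : ℝ} (h : CritClosePair Λ) : CritCloseOrMultiple Λ := by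
  intro T₀
  obtain ⟨γ, γ', hT₀, h2, hne, hz, hz', hd⟩ := h T₀
  exact ⟨γ, hT₀, h2, hz, Or.inr ⟨γ', hne, hz', hd⟩⟩

/-! ### §2 K-L24-1 — the (κ,σ)-edge -/

/-- **`H_Σ(κ,σ)`**: for some `c > 0` and all large `T`, at least `c·T·(log T)^{1−κ}` ordinates
`2 ≤ γ ≤ T` of critical zeros of `ζ` have a close critical neighbour (or are multiple) at the
Conrey–Iwaniec radius `gapRadius ((log T)^{−σ}) γ = π (1 − (log T)^{−σ}) / log γ`. -/
def SubnormalGapsHypothesisSigma (κ σ : ℝ) : Prop :=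
  ∃ c : ℝ, 0 < c ∧ ∃ T₀ : ℝ, ∀ T : ℝ, T₀ ≤ T →
    c * T * Real.log T ^ (1 - κ) ≤
      ((closeZeroOrdinates riemannZeta (Real.log T ^ (-σ)) T).ncard : ℝ)

/-- Monotonicity: larger `κ` (fewer zeros demanded) and larger `σ` (larger radius) are WEAKER. -/
theorem SubnormalGapsHypothesisSigma.mono {κ κ' σ σ' : ℝ} (hκ : κ ≤ κ') (hσ : σ ≤ σ')
    (h : SubnormalGapsHypothesisSigma κ σ) : SubnormalGapsHypothesisSigma κ' σ' := by
  obtain ⟨c, hc, T₀, hT⟩ := h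
  refine ⟨c, hc, max T₀ (Real.exp 1), fun T hTge ↦ ?_⟩
  have hT₀ : T₀ ≤ T := le_trans (le_max_left _ _) hTge
  have hlog : 1 ≤ Real.log T := one_le_log_of_exp_one_le (le_trans (le_max_right _ _) hTge)
  have hTpos : 0 < T := lt_of_lt_of_le (Real.exp_pos 1) (le_trans (le_max_right _ _) hTge)
  have h1 : Real.log T ^ (1 - κ') ≤ Real.log T ^ (1 - κ) :=
    Real.rpow_le_rpow_of_exponent_le hlog (by linarith)
  have h2 : Real.log T ^ (-σ') ≤ Real.log T ^ (-σ) :=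
    Real.rpow_le_rpow_of_exponent_le hlog (by linarith)
  have hsub : closeZeroOrdinates riemannZeta (Real.log T ^ (-σ)) T ⊆
      closeZeroOrdinates riemannZeta (Real.log T ^ (-σ')) T :=
    closeZeroOrdinates_anti riemannZeta h2 T
  have hcard : ((closeZeroOrdinates riemannZeta (Real.log T ^ (-σ)) T).ncard : ℝ) ≤
      (closeZeroOrdinates riemannZeta (Real.log T ^ (-σ')) T).ncard := by
    exact_mod_cast Set.ncard_le_ncard hsub (closeZeroOrdinates_riemannZeta_finite _ _)
  calc c * T * Real.log T ^ (1 - κ') ≤ c * T * Real.log T ^ (1 - κ) :=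
        mul_le_mul_of_nonneg_left h1 (by positivity)
    _ ≤ _ := hT T hT₀
    _ ≤ _ := hcard

/-- Radius comparison: for `σ ≥ ½`, `e ≤ T`, `2 ≤ γ ≤ T` the Theorem-1.2 radius `ciRadius γ` is at most
the Theorem-1.1 radius at `α = (log T)^{−σ}`. -/
theorem ciRadius_le_gapRadius {σ T γ : ℝ} (hσ : 1 / 2 ≤ σ) (hT : Real.exp 1 ≤ T) (hγ2 : 2 ≤ γ)
    (hγT : γ ≤ T) : ciRadius γ ≤ gapRadius (Real.log T ^ (-σ)) γ := by
  have hlogγ : 0 < Real.log γ := Real.log_pos (by linarith)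
  have hlogT : 1 ≤ Real.log T := one_le_log_of_exp_one_le hT
  have hsqrtγ : 0 < Real.sqrt (Real.log γ) := Real.sqrt_pos.2 hlogγ
  -- key: (log T)^{-σ} ≤ 1/√(log γ)
  have k1 : Real.log T ^ (-σ) ≤ Real.log T ^ (-(1 / 2 : ℝ)) :=
    Real.rpow_le_rpow_of_exponent_le hlogT (by linarith)
  have k2 : Real.log T ^ (-(1 / 2 : ℝ)) = (Real.sqrt (Real.log T))⁻¹ := by
    rw [Real.rpow_neg (by linarith), Real.sqrt_eq_rpow]
  have k3 : (Real.sqrt (Real.log T))⁻¹ ≤ (Real.sqrt (Real.log γ))⁻¹ :=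
    inv_anti₀ hsqrtγ (Real.sqrt_le_sqrt (Real.log_le_log (by linarith) hγT))
  have key : Real.log T ^ (-σ) ≤ 1 / Real.sqrt (Real.log γ) := by
    rw [one_div]; exact k1.trans (k2.le.trans k3)
  unfold ciRadius gapRadius
  rw [div_mul_eq_mul_div]
  exact div_le_div_of_nonneg_right
    (mul_le_mul_of_nonneg_left (by linarith) Real.pi_pos.le) hlogγ.le

/-- **X ⇒ `H_Σ(1/5, σ)` for every `σ ≥ ½`** (Theorem 1.2's hypothesis sits at the interior point
`(κ,σ) = (1/5, 1/2)` of the edge). -/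
theorem sigma_of_subnormalGaps {c : ℝ} (hc : 0 < c) (hX : SubnormalGapsHypothesis c) {σ : ℝ}
    (hσ : 1 / 2 ≤ σ) : SubnormalGapsHypothesisSigma (1 / 5) σ := by
  classical
  -- junk below height 2
  set S₂ : Set ℝ := {γ : ℝ | 0 < γ ∧ γ ≤ 2 ∧ riemannZeta (1 / 2 + γ * I) = 0} with hS₂
  have hS₂fin : S₂.Finite := critOrdinates_finite 2
  set M : ℕ := S₂.ncard with hM
  refine ⟨c / 2, by positivity, max 2001 (2 * M / c), fun T hTge ↦ ?_⟩
  have hT2001 : (2001 : ℝ) ≤ T := le_trans (le_max_left _ _) hTge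
  have hTe : Real.exp 1 ≤ T := exp_one_le_2001.trans hT2001
  have hTpos : 0 < T := by linarith
  have hlog : 1 ≤ Real.log T := one_le_log_of_exp_one_le hTe
  -- inclusion  closeCriticalZeros T ⊆ closeZeroOrdinates ζ α_T T ∪ S₂
  have hsub : closeCriticalZeros T ⊆
      closeZeroOrdinates riemannZeta (Real.log T ^ (-σ)) T ∪ S₂ := by
    intro γ hγ
    obtain ⟨h0, hγT, hclose⟩ := hγ
    by_cases h2 : 2 ≤ γ
    · left
      refine ⟨h2, hγT, ?_⟩
      exact ((hasCloseZero_riemannZeta_ciRadius_iff γ).2 hclose).mono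
        (ciRadius_le_gapRadius hσ hTe h2 hγT)
    · right
      exact ⟨h0, by linarith, hclose.1⟩
  have hfin : (closeZeroOrdinates riemannZeta (Real.log T ^ (-σ)) T ∪ S₂).Finite :=
    (closeZeroOrdinates_riemannZeta_finite _ _).union hS₂fin
  have hcard : ((closeCriticalZeros T).ncard : ℝ) ≤
      (closeZeroOrdinates riemannZeta (Real.log T ^ (-σ)) T).ncard + M := by
    have h1 := Set.ncard_le_ncard hsub hfin
    have h2 := Set.ncard_union_le (closeZeroOrdinates riemannZeta (Real.log T ^ (-σ)) T) S₂
    exact_mod_cast h1.trans h2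
  have hX' := hX T hT2001
  have hpow : 1 ≤ Real.log T ^ ((4 : ℝ) / 5) := Real.one_le_rpow hlog (by norm_num)
  have hMle : (M : ℝ) ≤ c / 2 * T := by
    have : 2 * (M : ℝ) / c ≤ T := le_trans (le_max_right _ _) hTge
    rw [div_le_iff₀ hc] at this
    linarith
  have hexp : (1 : ℝ) - 1 / 5 = 4 / 5 := by norm_num
  rw [hexp]
  have : c / 2 * T * 1 ≤ c / 2 * T * Real.log T ^ ((4 : ℝ) / 5) :=
    mul_le_mul_of_nonneg_left hpow (by positivity)
  nlinarith

/-- The CI Theorem-1.2 point of the edge: `X ⇒ H_Σ(1/5, 1/2)`. -/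
theorem sigma_half_of_subnormalGaps {c : ℝ} (hc : 0 < c) (hX : SubnormalGapsHypothesis c) :
    SubnormalGapsHypothesisSigma (1 / 5) (1 / 2) :=
  sigma_of_subnormalGaps hc hX le_rfl

/-- **Budget of the edge.** Plugging `H_Σ(κ,σ)` into Theorem 1.1 with `log T = (log q)^{A+6}`,
`α = (log T)^{−σ}`: the hypothesis count `c_CI·T·log T/(α (log q)^A) = c_CI·T·(log T)^{1+σ−A/(A+6)}`
is dominated by `c·T·(log T)^{1−κ}` for large `q` iff `A/(A+6) > κ + σ`; such `A ≥ 0` exists iff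
`κ + σ < 1`, and then every `A > 6(κ+σ)/(1−κ−σ)` works (exponent of the leaf: `4A+18`). -/
theorem sigma_budget_pos {κ σ A : ℝ} (hsum : κ + σ < 1) (hA : 6 * (κ + σ) / (1 - (κ + σ)) < A)
    (hA0 : 0 ≤ A) : κ + σ < A / (A + 6) := by
  have h1 : 0 < 1 - (κ + σ) := by linarith
  have h2 : 0 < A + 6 := by linarith
  rw [lt_div_iff₀ h2]
  rw [div_lt_iff₀ h1] at hA
  nlinarith

/-- Conversely no `A ≥ 0` works when `κ + σ ≥ 1`. -/
theorem sigma_budget_neg {κ σ A : ℝ} (hsum : 1 ≤ κ + σ) (hA0 : 0 ≤ A) : ¬ κ + σ < A / (A + 6) := by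
  intro h
  have h2 : 0 < A + 6 := by linarith
  rw [lt_div_iff₀ h2] at h
  nlinarith

/-- Theorem 1.2's interior point: `κ + σ = 1/5 + 1/2 = 7/10 < 1`, `6·(7/10)/(3/10) = 14`, so any
`A > 14` works and the typed exponent is `4A + 18 → 74⁺ (< 90 printed)`. -/
example : 6 * ((1 : ℝ) / 5 + 1 / 2) / (1 - (1 / 5 + 1 / 2)) = 14 := by norm_num

end Summit.Parity.GeneralizedHardyLittlewood.Theorems.PrimeLevelFamEdgeIdeaDeltas.WucSigma

end
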